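import Summits.QuantumFields.YangMills.Theorems.UnitScaleTiltProp8EulerLagrangeRegPrAllL
import Summits.QuantumFields.YangMills.Theorems.UnitScaleTiltProp8EulerLagrangeLie
import Summits.QuantumFields.YangMills.Theorems.UnitScaleTiltProp7FirstVariationCurrent
import HarnessLib

/-!
# Route `UnitScaleTilt`, crux K1 child «MinimiserStabilityRegPr» (stmt-QuantumFields-19200) — «blend-ℓ²» line (OWNER RULING g24-№1 §B), stub S4
# `firstVariationFibre`, sub-lemma S4c: **THE FIRST VARIATION OF AN R2-CRITICAL CONFIGURATION ALONG AN 𝔰𝔲(2) DIRECTION IS CONTROLLED BY THE FIBRE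
# CORRECTOR ON THE TREE BONDS** — `|Lin_U(A)| ≤ ε₀·L^{−3(K−n)}·Σ_{b ∈ T₀}‖A_b − ξ_b‖`, `ξ` the velocity of a curve INSIDE THE FIBRE `𝔅_k(V)` that agrees with
# `t ↦ e^{tA}U` off the tree `T₀` (p2's corrected lift, base point and velocity now DISPLAYED)

Cell `ym3-torus` ∕ width seat `ym-ust-19200-w1` (gen 0; HUMAN RULING D-0037 — YM₃ on T³ is ladder rung R3, not the Clay problem).  WHY.  S4 (CARD-19200-V3-g9 §5;
schema (iii) of `Prop7BlendClause1.atMostOneCriticalOrbit_of_reprSchema_T3`): `Lin_U(Y) ≥ −C_L·Σ‖Y‖²`.  After S4a ∕ S4b (`Prop7FirstVariationHerm`: the Hermitian part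
costs `(ε₀/2)L^{−3k}Σ‖Y‖²`) it remains to bound `Lin_U(A)` for the 𝔰𝔲(2)-part `A`.  The manifold part of the CARD's mechanism («one-sided minimality along a corrected
path in the fibre») is ALREADY in the tree, two-sided and without an implicit-function theorem: p2's corrected lift `IterTangent.exists_iter_lift_curve` and the
Euler–Lagrange theorem `Prop8Criticality.lin_eq_zero_of_isMinOn_of_hasDerivAt` (all `L`: `Prop8CriticalityAllL.t0_data_of_regPr_allL`).  Their published
corollaries (`exists_tangent_lin_eq_zero_of_isCritR2_family(_regPr_allL)`) hide the lifted curve behind `∃ ξ` with `ξ` specified only OFF the tree; S4 needs the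
curve itself (it lies in the fibre, so its velocity `ξ` is annihilated by the linearised `k`-fold average — the input of S4d ∕ S4e, which bound `ξ − A` on the tree
by the tree right inverse and the second-order remainder).  This file re-runs the same proof DISPLAYING `γ` and `ξ`, and draws the bound on `Lin_U(A)`.

WHAT IS PROVED (sorry-free, no definition).
* **`exists_fibre_curve_lin_eq_zero_of_isCritR2`** — for `U₀` R2-critical over the fibre of `V`, `U₀ ∈ 𝔘_k(ε₀)` with `10¹⁰L⁶ε₀ ≤ 1`, every tower `T` (closed
  downwards, `T_{K−n}` = everything) and every bondwise-differentiable ambient family `Γ₀` through `U₀`: there are a family `γ` and velocities `ξ` with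
  `γ(0) = U₀`, `γ` bondwise differentiable, **`γ(t) ∈ fibre(V)` for `t` near `0`**, `HasDerivAt (γ(·)(b)U₀(b)*) (ξ b) 0` at EVERY bond, `γ(t)(b) = Γ₀(t)(b)` near
  `0` off `T₀`, and `Lin_{U₀}(ξ) = 0`.
* **`abs_lin_le_tree_of_su2`** — for such `U₀` and an 𝔰𝔲(2)-valued bond field `A` (skew-adjoint, traceless): with `Γ₀(t)(b) = e^{tA_b}U₀(b)` the above `ξ` has
  `ξ_b = A_b` off `T₀` and **`|Lin_{U₀}(A)| ≤ ε₀·(L^{K−n})⁻³·Σ_b‖A_b − ξ_b‖`** (the sum lives on `T₀`), by the current identity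
  `Prop7FirstVariationCurrent.lin_eq_neg_half_sum_re_trace_mul_covDivT` and the divergence clause of (6).

HONEST SCOPE.  Re-export + bookkeeping; the SIZE of `ξ − A` on the tree (S4d: the tree right inverse of the linearised `k`-fold average at a curved background,
`‖·‖₁→₁ ≤ O(L^{k(d−1)})`; S4e: the second-order remainder of the `k`-fold average on the secant inside the fibre) is NOT here.  Count-neutral helper toward
stmt-QuantumFields-19200 (`--supports`); nothing continuum ∕ OS ∕ mass-gap ∕ Clay.

References: T. Bałaban, CMP **102** (1985) 277–309 [Balaban1985Variational] ((2), (6) p.278, (127) p.297, (141)–(143) p.299, (158) p.302); CMP **99** (1985)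
389–434 [Balaban1985BackgroundPropagators] ((3.11) p.392); [Balaban1987RG1] (0.4), (0.11) p.253.
-/

noncomputable section

open scoped BigOperators Matrix.Norms.L2Operator Matrix Topology
open Filter NormedSpace

namespace Summit.QuantumFields.YangMills.Theorems.Prop7FirstVariationFibreCurve

open Literature.MathematicalPhysics.QuantumFieldTheory.Balaban1983to89
open T4Continuum AveragingRT BlockAveraging BlockAveragingHaarAC BlockAveragingEMLHaarAC ExpMeanLog
open T3ContinuumYM3Torus T3UnitLawDensityEML T3ConstrainedMinimiser T3TiltDescent T3DescentFibreTower T3LevelShift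
open T3PrintedRegularMinimiser T3Thm1CarrierNative
open B10Eq27TorusAxialLog (unitsField toUField)
open B10Eq68TorusRegularity (covDivT)
open Summit.QuantumFields.YangMills.Theorems.BlockAvgCorrector (stokesConst)
open Summit.QuantumFields.YangMills.Theorems.Prop8Criticality (exists_iter_lift_curve lin_eq_zero_of_isMinOn_of_hasDerivAt exists_ball_subset_regPr
  expCurve_mem)
open Summit.QuantumFields.YangMills.Theorems.Prop8CriticalityAllL (t0_data_of_regPr_allL)
open Summit.QuantumFields.YangMills.Theorems.Prop7CovariantCoercivity (abs_re_trace_le)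
open Summit.QuantumFields.YangMills.Theorems.Prop7FirstVariationCurrent (lin_eq_neg_half_sum_re_trace_mul_covDivT)

variable (F : T3Family) {n K : ℕ}

/-- **THE CORRECTED LIFT OF AN AMBIENT FAMILY INTO THE FIBRE THROUGH AN R2-CRITICAL CONFIGURATION, WITH ITS VELOCITY, AND THE EULER–LAGRANGE EQUATION**
(p2's `exists_iter_lift_curve` + `lin_eq_zero_of_isMinOn_of_hasDerivAt`, with the curve `γ` and the velocity `ξ` displayed): `γ(0) = U₀`, `γ` bondwise
differentiable, `γ(t)` in the descent fibre of `V` for `t` near `0`, `ξ_b` the velocity of `γ(·)(b)U₀(b)*` at every bond, `γ = Γ₀` off `T₀` near `0`, and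
`Lin_{U₀}(ξ) = 0` (minimality of `U₀` over print's regular fibre (6)(e), an open condition around `U₀`, along `γ`).
[cite: Balaban1985Variational, (127) p.297, (158) p.302, (6) p.278] -/
theorem exists_fibre_curve_lin_eq_zero_of_isCritR2 (hnK : n ≤ K)
    {V : GaugeField (F.P n) 0 (Matrix.specialUnitaryGroup (Fin 2) ℂ)} {U₀ : GaugeField (F.P K) 0 (Matrix.specialUnitaryGroup (Fin 2) ℂ)}
    (hcrit : IsCritR2 F n K hnK V U₀) {ε₀ : ℝ} (hε₀ : 0 < ε₀) (hε : 10 ^ 10 * (F.L : ℝ) ^ 6 * ε₀ ≤ 1) (hU₀reg : RegPr F n K ε₀ U₀)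
    (T : (i : ℕ) → Set (PBond (F.P K) i)) (hT : ∀ i, i < K - n → ∀ c : PBond (F.P K) (i + 1), c ∈ T (i + 1) → centralBond c ∈ T i)
    (hTk : ∀ c : PBond (F.P K) (K - n), c ∈ T (K - n))
    (Γ₀ : ℝ → GaugeField (F.P K) 0 (Matrix.specialUnitaryGroup (Fin 2) ℂ)) (hΓ₀0 : Γ₀ 0 = U₀)
    (hΓ₀diff : ∀ b : PBond (F.P K) 0, DifferentiableAt ℝ (fun t : ℝ => (Γ₀ t b : Matrix (Fin 2) (Fin 2) ℂ)) 0) :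
    ∃ (γ : ℝ → GaugeField (F.P K) 0 (Matrix.specialUnitaryGroup (Fin 2) ℂ)) (ξ : PBond (F.P K) 0 → Matrix (Fin 2) (Fin 2) ℂ),
      γ 0 = U₀ ∧
      (∀ b : PBond (F.P K) 0, DifferentiableAt ℝ (fun t : ℝ => (γ t b : Matrix (Fin 2) (Fin 2) ℂ)) 0) ∧
      (∀ᶠ t in 𝓝 (0 : ℝ), γ t ∈ fibre F ℰp n K hnK V) ∧
      (∀ b : PBond (F.P K) 0,
        HasDerivAt (fun t : ℝ => (γ t b : Matrix (Fin 2) (Fin 2) ℂ) * star (U₀ b : Matrix (Fin 2) (Fin 2) ℂ)) (ξ b) 0) ∧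
      (∀ b : PBond (F.P K) 0, b ∉ T 0 → ∀ᶠ t in 𝓝 (0 : ℝ), γ t b = Γ₀ t b) ∧
      ∑ p : Plaq (F.P K) 0, (1 / 2) * ((((((GaugeField.plaqHol U₀ p : Matrix.specialUnitaryGroup (Fin 2) ℂ) : Matrix (Fin 2) (Fin 2) ℂ)) - 1)ᴴ
          * ((ξ ⟨p.src, p.μ⟩
              + (U₀ ⟨p.src, p.μ⟩ : Matrix (Fin 2) (Fin 2) ℂ) * ξ ⟨p.src.shift p.μ, p.ν⟩ * star (U₀ ⟨p.src, p.μ⟩ : Matrix (Fin 2) (Fin 2) ℂ)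
              - ((U₀ ⟨p.src, p.μ⟩ * U₀ ⟨p.src.shift p.μ, p.ν⟩ * (U₀ ⟨p.src.shift p.ν, p.μ⟩)⁻¹ : Matrix.specialUnitaryGroup (Fin 2) ℂ) : Matrix (Fin 2) (Fin 2) ℂ)
                  * ξ ⟨p.src.shift p.ν, p.μ⟩
                  * star ((U₀ ⟨p.src, p.μ⟩ * U₀ ⟨p.src.shift p.μ, p.ν⟩ * (U₀ ⟨p.src.shift p.ν, p.μ⟩)⁻¹ : Matrix.specialUnitaryGroup (Fin 2) ℂ) : Matrix (Fin 2) (Fin 2) ℂ)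
              - ((GaugeField.plaqHol U₀ p : Matrix.specialUnitaryGroup (Fin 2) ℂ) : Matrix (Fin 2) (Fin 2) ℂ) * ξ ⟨p.src, p.ν⟩
                  * star ((GaugeField.plaqHol U₀ p : Matrix.specialUnitaryGroup (Fin 2) ℂ) : Matrix (Fin 2) (Fin 2) ℂ))
            * ((GaugeField.plaqHol U₀ p : Matrix.specialUnitaryGroup (Fin 2) ℂ) : Matrix (Fin 2) (Fin 2) ℂ))).trace).re = 0 := by
  classical
  obtain ⟨ht₀, hsmall, hU₀it⟩ := t0_data_of_regPr_allL F hε₀ hε hU₀reg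
  obtain ⟨e, -, hreg, hmin⟩ := hcrit
  have hU₀fib : U₀ ∈ fibre F ℰp n K hnK V := ((mem_regFibrePr_iff (F := F)).mp hreg).1
  have hU₀rege : RegPr F n K e U₀ := ((mem_regFibrePr_iff (F := F)).mp hreg).2
  obtain ⟨δ, hδ, hball⟩ := exists_ball_subset_regPr F n K e U₀ hU₀rege
  have hk : K - n ≤ (F.P K).m + (F.P K).K := by
    show K - n ≤ F.m + K; omega
  have hsm : ∀ i, i < K - n → PlaqSmall ((10800 * (F.L : ℝ) + 1) * ε₀)
      (Averaging.iter (fun i => blockAvg (P := F.P K) (j := i) (expMeanLogSU (n := Fin 2))) i (Γ₀ 0)) := by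
    rw [hΓ₀0]; exact hU₀it
  obtain ⟨γ, hγ0, hγdiff, hγev, hγT⟩ := exists_iter_lift_curve (P := F.P K) ht₀ hsmall (K - n) hk Γ₀ hΓ₀diff hsm T hT
    (fun _ => Averaging.iter (fun i => blockAvg (P := F.P K) (j := i) (expMeanLogSU (n := Fin 2))) (K - n) U₀)
    (fun _ => differentiableAt_const _) (by rw [hΓ₀0]) (fun c hc => absurd (hTk c) hc)
  have hγ0' : γ 0 = U₀ := hγ0.trans hΓ₀0
  -- the lifted family stays in the fibre, hence (near `0`) in print's regular fibre (6)(e)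
  have hγfib : ∀ᶠ t in 𝓝 (0 : ℝ), γ t ∈ fibre F ℰp n K hnK V := by
    filter_upwards [hγev] with t ht
    rw [mem_fibre_iff] at hU₀fib ⊢
    rw [← hU₀fib]
    exact congrArg (fun W => fieldShift _ W) ht
  have hγS : ∀ᶠ t in 𝓝 (0 : ℝ), γ t ∈ regFibrePr F n K hnK e V := by
    have hnear : ∀ b : PBond (F.P K) 0, ∀ᶠ t in 𝓝 (0 : ℝ),
        ‖((γ t b : Matrix.specialUnitaryGroup (Fin 2) ℂ) : Matrix (Fin 2) (Fin 2) ℂ) - (U₀ b : Matrix (Fin 2) (Fin 2) ℂ)‖ < δ := by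
      intro b
      have h1 : Tendsto (fun t : ℝ => ((γ t b : Matrix.specialUnitaryGroup (Fin 2) ℂ) : Matrix (Fin 2) (Fin 2) ℂ)) (𝓝 0)
          (𝓝 ((U₀ b : Matrix.specialUnitaryGroup (Fin 2) ℂ) : Matrix (Fin 2) (Fin 2) ℂ)) := by
        have := (hγdiff b).continuousAt.tendsto
        rwa [hγ0'] at this
      have h2 := h1 (Metric.ball_mem_nhds _ hδ)
      filter_upwards [h2] with t ht
      rwa [Set.mem_preimage, Metric.mem_ball, dist_eq_norm] at ht
    filter_upwards [hγfib, Filter.eventually_all.mpr hnear] with t ht hdist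
    exact (mem_regFibrePr_iff (F := F)).mpr ⟨ht, hball (γ t) hdist⟩
  set ξ : PBond (F.P K) 0 → Matrix (Fin 2) (Fin 2) ℂ := fun b =>
    deriv (fun t : ℝ => ((γ t b : Matrix.specialUnitaryGroup (Fin 2) ℂ) : Matrix (Fin 2) (Fin 2) ℂ) * star (U₀ b : Matrix (Fin 2) (Fin 2) ℂ)) 0 with hξ
  have hξd : ∀ b, HasDerivAt (fun t : ℝ => ((γ t b : Matrix.specialUnitaryGroup (Fin 2) ℂ) : Matrix (Fin 2) (Fin 2) ℂ) * star (U₀ b : Matrix (Fin 2) (Fin 2) ℂ))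
      (ξ b) 0 :=
    fun b => ((hγdiff b).mul_const _).hasDerivAt
  exact ⟨γ, ξ, hγ0', hγdiff, hγfib, hξd, hγT, lin_eq_zero_of_isMinOn_of_hasDerivAt hmin γ hγS hγ0' ξ hξd⟩

/-- **S4c: `|Lin_U(A)| ≤ ε₀·(L^{K−n})⁻³·Σ_b‖A_b − ξ_b‖` FOR AN 𝔰𝔲(2)-DIRECTION `A` AT AN R2-CRITICAL `U₀ ∈ 𝔘_k(ε₀)`**, where `ξ` is the velocity of the corrected
lift into the fibre of the exponential family `Γ₀(t)(b) = e^{tA_b}U₀(b)` (so `ξ = A` off the tree `T₀`, and the sum lives on `T₀`): `Lin_{U₀}(ξ) = 0` by the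
Euler–Lagrange theorem, `Lin_{U₀}(A) − Lin_{U₀}(ξ) = −½Σ_b Re Tr((A_b − ξ_b)J_b)` by the current identity, and `‖J_b‖ < ε₀L^{−3(K−n)}` by the divergence clause of (6).
[cite: Balaban1985Variational, (2), (6) p.278, (141)–(143) p.299, (158) p.302; Balaban1985BackgroundPropagators, (3.11) p.392] -/
theorem abs_lin_le_tree_of_su2 (hnK : n ≤ K)
    {V : GaugeField (F.P n) 0 (Matrix.specialUnitaryGroup (Fin 2) ℂ)} {U₀ : GaugeField (F.P K) 0 (Matrix.specialUnitaryGroup (Fin 2) ℂ)}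
    (hcrit : IsCritR2 F n K hnK V U₀) {ε₀ : ℝ} (hε₀ : 0 < ε₀) (hε : 10 ^ 10 * (F.L : ℝ) ^ 6 * ε₀ ≤ 1) (hU₀reg : RegPr F n K ε₀ U₀)
    (T : (i : ℕ) → Set (PBond (F.P K) i)) (hT : ∀ i, i < K - n → ∀ c : PBond (F.P K) (i + 1), c ∈ T (i + 1) → centralBond c ∈ T i)
    (hTk : ∀ c : PBond (F.P K) (K - n), c ∈ T (K - n))
    (A : PBond (F.P K) 0 → Matrix (Fin 2) (Fin 2) ℂ) (hA : ∀ b, A b ∈ skewAdjoint (Matrix (Fin 2) (Fin 2) ℂ)) (htr : ∀ b, (A b).trace = 0) :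
    ∃ (γ : ℝ → GaugeField (F.P K) 0 (Matrix.specialUnitaryGroup (Fin 2) ℂ)) (ξ : PBond (F.P K) 0 → Matrix (Fin 2) (Fin 2) ℂ),
      γ 0 = U₀ ∧
      (∀ b : PBond (F.P K) 0, DifferentiableAt ℝ (fun t : ℝ => (γ t b : Matrix (Fin 2) (Fin 2) ℂ)) 0) ∧
      (∀ᶠ t in 𝓝 (0 : ℝ), γ t ∈ fibre F ℰp n K hnK V) ∧
      (∀ b : PBond (F.P K) 0,
        HasDerivAt (fun t : ℝ => (γ t b : Matrix (Fin 2) (Fin 2) ℂ) * star (U₀ b : Matrix (Fin 2) (Fin 2) ℂ)) (ξ b) 0) ∧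
      (∀ b : PBond (F.P K) 0, b ∉ T 0 → ξ b = A b) ∧
      |∑ p : Plaq (F.P K) 0, (1 / 2) * ((((((GaugeField.plaqHol U₀ p : Matrix.specialUnitaryGroup (Fin 2) ℂ) : Matrix (Fin 2) (Fin 2) ℂ)) - 1)ᴴ
          * ((A ⟨p.src, p.μ⟩
              + (U₀ ⟨p.src, p.μ⟩ : Matrix (Fin 2) (Fin 2) ℂ) * A ⟨p.src.shift p.μ, p.ν⟩ * star (U₀ ⟨p.src, p.μ⟩ : Matrix (Fin 2) (Fin 2) ℂ)
              - ((U₀ ⟨p.src, p.μ⟩ * U₀ ⟨p.src.shift p.μ, p.ν⟩ * (U₀ ⟨p.src.shift p.ν, p.μ⟩)⁻¹ : Matrix.specialUnitaryGroup (Fin 2) ℂ) : Matrix (Fin 2) (Fin 2) ℂ)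
                  * A ⟨p.src.shift p.ν, p.μ⟩
                  * star ((U₀ ⟨p.src, p.μ⟩ * U₀ ⟨p.src.shift p.μ, p.ν⟩ * (U₀ ⟨p.src.shift p.ν, p.μ⟩)⁻¹ : Matrix.specialUnitaryGroup (Fin 2) ℂ) : Matrix (Fin 2) (Fin 2) ℂ)
              - ((GaugeField.plaqHol U₀ p : Matrix.specialUnitaryGroup (Fin 2) ℂ) : Matrix (Fin 2) (Fin 2) ℂ) * A ⟨p.src, p.ν⟩
                  * star ((GaugeField.plaqHol U₀ p : Matrix.specialUnitaryGroup (Fin 2) ℂ) : Matrix (Fin 2) (Fin 2) ℂ))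
            * ((GaugeField.plaqHol U₀ p : Matrix.specialUnitaryGroup (Fin 2) ℂ) : Matrix (Fin 2) (Fin 2) ℂ))).trace).re|
        ≤ ε₀ * (((F.L : ℝ) ^ (K - n)) ^ 3)⁻¹ * ∑ b : PBond (F.P K) 0, ‖A b - ξ b‖ := by
  -- the exponential family and its velocities
  set Γ₀ : ℝ → GaugeField (F.P K) 0 (Matrix.specialUnitaryGroup (Fin 2) ℂ) :=
    fun t b => ⟨exp (t • A b) * (U₀ b : Matrix (Fin 2) (Fin 2) ℂ), expCurve_mem (hA b) (htr b) (U₀ b) t⟩ with hΓ₀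
  have hΓ₀0 : Γ₀ 0 = U₀ := by
    funext b; apply Subtype.ext
    show exp ((0 : ℝ) • A b) * (U₀ b : Matrix (Fin 2) (Fin 2) ℂ) = (U₀ b : Matrix (Fin 2) (Fin 2) ℂ)
    rw [zero_smul, exp_zero, one_mul]
  have hΓ₀d : ∀ b : PBond (F.P K) 0, HasDerivAt (fun t : ℝ => (Γ₀ t b : Matrix (Fin 2) (Fin 2) ℂ)) (A b * (U₀ b : Matrix (Fin 2) (Fin 2) ℂ)) 0 := by
    intro b
    have h1 := (hasDerivAt_exp_smul_const' (A b) (0 : ℝ)).mul_const (U₀ b : Matrix (Fin 2) (Fin 2) ℂ)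
    simp only [zero_smul, exp_zero, mul_one] at h1
    exact h1
  obtain ⟨γ, ξ, hγ0, hγdiff, hγfib, hξd, hγT, hlin⟩ := exists_fibre_curve_lin_eq_zero_of_isCritR2 F hnK hcrit hε₀ hε hU₀reg T hT hTk Γ₀ hΓ₀0
    (fun b => (hΓ₀d b).differentiableAt)
  -- off the tree the velocity is `A`
  have hUU : ∀ b : PBond (F.P K) 0, (U₀ b : Matrix (Fin 2) (Fin 2) ℂ) * star (U₀ b : Matrix (Fin 2) (Fin 2) ℂ) = 1 :=
    fun b => Matrix.mem_unitaryGroup_iff.mp (U₀ b).2.1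
  have hξA : ∀ b : PBond (F.P K) 0, b ∉ T 0 → ξ b = A b := by
    intro b hb
    have h1 : HasDerivAt (fun t : ℝ => (Γ₀ t b : Matrix (Fin 2) (Fin 2) ℂ) * star (U₀ b : Matrix (Fin 2) (Fin 2) ℂ)) (A b) 0 := by
      have := (hΓ₀d b).mul_const (star (U₀ b : Matrix (Fin 2) (Fin 2) ℂ))
      rwa [mul_assoc, hUU b, mul_one] at this
    have h2 : HasDerivAt (fun t : ℝ => (Γ₀ t b : Matrix (Fin 2) (Fin 2) ℂ) * star (U₀ b : Matrix (Fin 2) (Fin 2) ℂ)) (ξ b) 0 := by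
      refine (hξd b).congr_of_eventuallyEq ?_
      filter_upwards [hγT b hb] with t ht
      rw [ht]
    exact h2.unique h1
  refine ⟨γ, ξ, hγ0, hγdiff, hγfib, hξd, hξA, ?_⟩
  -- `Lin(A) = Lin(A) − Lin(ξ) = −½Σ Re Tr((A − ξ)J)`
  have hUreg3 : DivSmall F n K ε₀ U₀ := hU₀reg.2
  rw [← sub_zero (∑ p : Plaq (F.P K) 0, _), ← hlin, lin_eq_neg_half_sum_re_trace_mul_covDivT, lin_eq_neg_half_sum_re_trace_mul_covDivT, ← mul_sub,
    ← Finset.sum_sub_distrib]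
  have hsub : ∀ b : PBond (F.P K) 0,
      ((A b * covDivT 1 (unitsField (toUField U₀)) b.dir b.src).trace).re - ((ξ b * covDivT 1 (unitsField (toUField U₀)) b.dir b.src).trace).re
        = (((A b - ξ b) * covDivT 1 (unitsField (toUField U₀)) b.dir b.src).trace).re := by
    intro b; rw [Matrix.sub_mul, Matrix.trace_sub, Complex.sub_re]
  simp only [hsub]
  have hpow : ((F.L : ℝ)⁻¹) ^ (3 * (K - n)) = (((F.L : ℝ) ^ (K - n)) ^ 3)⁻¹ := by rw [inv_pow, mul_comm, pow_mul]
  have hb : ∀ b : PBond (F.P K) 0, |(((A b - ξ b) * covDivT 1 (unitsField (toUField U₀)) b.dir b.src).trace).re|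
      ≤ 2 * (‖A b - ξ b‖ * (ε₀ * (((F.L : ℝ) ^ (K - n)) ^ 3)⁻¹)) := by
    intro b
    have h1 := abs_re_trace_le ((A b - ξ b) * covDivT 1 (unitsField (toUField U₀)) b.dir b.src)
    have hJ : ‖covDivT 1 (unitsField (toUField U₀)) b.dir b.src‖ ≤ ε₀ * (((F.L : ℝ) ^ (K - n)) ^ 3)⁻¹ := by rw [← hpow]; exact (hUreg3 b).le
    calc |(((A b - ξ b) * covDivT 1 (unitsField (toUField U₀)) b.dir b.src).trace).re|
        ≤ 2 * ‖(A b - ξ b) * covDivT 1 (unitsField (toUField U₀)) b.dir b.src‖ := by simpa using h1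
      _ ≤ 2 * (‖A b - ξ b‖ * (ε₀ * (((F.L : ℝ) ^ (K - n)) ^ 3)⁻¹)) :=
          mul_le_mul_of_nonneg_left ((norm_mul_le _ _).trans (mul_le_mul_of_nonneg_left hJ (norm_nonneg _))) (by norm_num)
  rw [abs_mul, abs_neg, abs_of_pos (by norm_num : (0 : ℝ) < 1 / 2)]
  calc (1 / 2) * |∑ b : PBond (F.P K) 0, (((A b - ξ b) * covDivT 1 (unitsField (toUField U₀)) b.dir b.src).trace).re|
      ≤ (1 / 2) * ∑ b : PBond (F.P K) 0, 2 * (‖A b - ξ b‖ * (ε₀ * (((F.L : ℝ) ^ (K - n)) ^ 3)⁻¹)) :=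
        mul_le_mul_of_nonneg_left ((Finset.abs_sum_le_sum_abs _ _).trans (Finset.sum_le_sum fun b _ => hb b)) (by norm_num)
    _ = ε₀ * (((F.L : ℝ) ^ (K - n)) ^ 3)⁻¹ * ∑ b : PBond (F.P K) 0, ‖A b - ξ b‖ := by
        rw [← Finset.mul_sum, ← Finset.sum_mul]; ring

end Summit.QuantumFields.YangMills.Theorems.Prop7FirstVariationFibreCurve

end
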